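import Mathlib
import Summits.NavierStokesRegularity.NavierStokesRegularity.Theorems.EulerZoomLiouvillePowerGaugeEulerLiouvillePowerClockNegRate
import HarnessLib

/-!
# TAME NEGATIVE-RATE DISCRETE CLOCKS about a time `T` on a past sub-slab are trivial
# (crux `EulerZoomLiouville.PowerGaugeEulerLiouville` = stmt-NavierStokesRegularity-19832; line `logtime-breathers`, residue T4/T5 — the
# discrete twin of this seat's `…PowerClockNegRate`, Lagrangian form)

Route `EulerZoomLiouville` (NavierStokesRegularity); extra-width seat ns-ezl-w7 g0 (LEAD ns-typeII-p2 g11).  A power clock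
`u(τ, x) = (T−τ)^{g−1} W((T−τ)^{−g} x)` is invariant under the whole group `τ ↦ T − μ(T−τ)`, `x ↦ μ^{g} x`, `u ↦ μ^{1−g} u` (`μ > 0`); a DISCRETE CLOCK
about the time `T` with rate `g` on the past sub-slab `(−∞, T₁)` (`T₁ ≤ 0`, `T₁ ≤ T`) is a member invariant under ONE element `μ > 1`:

> `u(τ, x) = μ^{1−g} · u(T − μ(T−τ), μ^{g} x)` for all `τ < T₁` and all `x`

(no profile in between; the tree's `IsDiscreteClock` is the case `T = 0` on the whole slab, where the `A`-gauge kills every slow rate).  For a NEGATIVE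
rate `g < 0` there is no profile equation, hence no local-energy lever (this seat's weak-class `NegClock.*` needs the exact clock); but the LAGRANGIAN lever
survives: iterating the symmetry, `u(T − μⁿ(T−τ), x) = μ^{−n(1−g)} u(τ, μ^{−ng} x)` (`NegRateDiscreteClock.iterate`), so bounds on ONE PERIOD WINDOW
`τ ∈ [T − μ(T − T₁ + 1), T₁)` propagate to the whole past with ALGEBRAIC fading: for `s < T₁ − 1`,

* `‖u(s, ·)‖ ≤ B (μ d₁)^{1−g} (T − s)^{−(1−g)}`, `d₁ = T − T₁ + 1`, exponent `1 − g > 1` (`NegRateDiscreteClock.norm_le_rpow_of_window`);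
* `‖∇u(s, ·)‖ ≤ C` and, for `‖x‖ ≥ δ`, `‖∇u(s, x)‖ ≤ C δ^{−q} (μ d₁)^{1−gq} (T − s)^{−(1−gq)}`, exponent `1 − gq > 1`
  (`NegRateDiscreteClock.norm_fderiv_le_of_window`, `…_of_le_norm`),

i.e. the member has an ALGEBRAICALLY FADING TAME PAST in the sense of this seat's `…FadingPowerPast`, and
`FadingPowerPast.ae_eq_zero_of_gauge_of_fadingPowerPast_of_norm_fderiv_le` concludes: `NegRateDiscreteClock.ae_eq_zero_of_gauge_of_tame`.
(Centre `x₀ = 0`: the trapped-set argument of `…FadingPowerPast` is written about the origin.)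

WHAT THIS IS NOT: not NS, not E — a classical stratum of the crux CLASS 19832 on the MODEL lattice, `--supports` stmt-19832; discrete clocks of
rate `g ∈ [0, ½ − ρ/5]` about `T > 0`, and untame ones, stay OPEN. [folklore; MajdaBertozziCUP2002 §2.5 (2.115)–(2.117), §4.2 (4.46)–(4.47);
line card `Cruxes/PowerGaugeEulerLiouville/Lines/logtime-breathers.md` T4/T5]
-/

noncomputable section

-- flat `Theorems/<Route><Decl>…` files of one crux share the namespace of the crux (tree convention: `Summit.<S>.<S>.…`)
set_option linter.dupNamespace false

open MeasureTheory Set Filter Topology Metric Function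
open scoped ENNReal NNReal

namespace Summit.NavierStokesRegularity.NavierStokesRegularity.Theorems.PowerGaugeEulerLiouville

open Literature.Analysis Literature.Analysis.FunctionSpaces Literature.Analysis.FluidPDE

namespace NegRateDiscreteClock

variable {u : ℝ → EuclideanSpace ℝ (Fin 3) → EuclideanSpace ℝ (Fin 3)} {p : ℝ → EuclideanSpace ℝ (Fin 3) → ℝ}
  {T T₁ μ g : ℝ}

/-! ### The orbit of the group element -/

/-- **Iteration of the discrete clock symmetry**: `u(T − μⁿ(T−τ), x) = (μ^{1−g})^{−n} · u(τ, (μ^{g})^{−n} x)` for `τ < T₁ ≤ T` (`μ ≥ 1`). [folklore] -/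
theorem iterate (hT : T₁ ≤ T) (hμ : 1 ≤ μ)
    (h : ∀ τ : ℝ, τ < T₁ → ∀ x, u τ x = μ ^ (1 - g) • u (T - μ * (T - τ)) (μ ^ g • x)) :
    ∀ n : ℕ, ∀ τ : ℝ, τ < T₁ → ∀ x,
      u (T - μ ^ n * (T - τ)) x = ((μ ^ (1 - g)) ^ n)⁻¹ • u τ (((μ ^ g) ^ n)⁻¹ • x) := by
  have hμ0 : 0 < μ := by linarith
  have ha : 0 < μ ^ (1 - g) := Real.rpow_pos_of_pos hμ0 _
  have hb : 0 < μ ^ g := Real.rpow_pos_of_pos hμ0 _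
  intro n
  induction n with
  | zero => intro τ hτ x; simp
  | succ n ih =>
    intro τ hτ x
    -- the intermediate time `τ_n = T − μⁿ(T − τ) < T₁`
    have hτT : 0 < T - τ := by linarith
    have hμn : 1 ≤ μ ^ n := one_le_pow₀ hμ
    have hτn : T - μ ^ n * (T - τ) < T₁ := by nlinarith
    -- the symmetry at `τ_n`, solved for the next slice
    have key : u (T - μ ^ (n + 1) * (T - τ)) x =
        (μ ^ (1 - g))⁻¹ • u (T - μ ^ n * (T - τ)) ((μ ^ g)⁻¹ • x) := by
      have h' := h (T - μ ^ n * (T - τ)) hτn ((μ ^ g)⁻¹ • x)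
      rw [smul_smul (μ ^ g), mul_inv_cancel₀ hb.ne', one_smul,
        show T - μ * (T - (T - μ ^ n * (T - τ))) = T - μ ^ (n + 1) * (T - τ) by ring] at h'
      rw [h', smul_smul, inv_mul_cancel₀ ha.ne', one_smul]
    have e1 : (μ ^ (1 - g))⁻¹ * ((μ ^ (1 - g)) ^ n)⁻¹ = ((μ ^ (1 - g)) ^ (n + 1))⁻¹ := by
      rw [pow_succ, mul_inv, mul_comm]
    have e2 : ((μ ^ g) ^ n)⁻¹ * (μ ^ g)⁻¹ = ((μ ^ g) ^ (n + 1))⁻¹ := by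
      rw [pow_succ, mul_inv]
    rw [key, ih τ hτ ((μ ^ g)⁻¹ • x), smul_smul, smul_smul, e1, e2]

/-- **Window decomposition in geometric time**: for `μ > 1`, `0 < d₁ ≤ D` there is `n ∈ ℕ` with `μⁿ d₁ ≤ D < μ^{n+1} d₁`. [folklore] -/
theorem exists_geometric_window (hμ : 1 < μ) {d₁ D : ℝ} (hd₁ : 0 < d₁) (hD : d₁ ≤ D) :
    ∃ n : ℕ, μ ^ n * d₁ ≤ D ∧ D < μ ^ (n + 1) * d₁ := by
  have hμ0 : 0 < μ := by linarith
  have hlog : 0 < Real.log μ := Real.log_pos hμ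
  set L : ℝ := Real.log (D / d₁) / Real.log μ with hL
  have hDd : 1 ≤ D / d₁ := by rw [le_div_iff₀ hd₁]; linarith
  have hL0 : 0 ≤ L := div_nonneg (Real.log_nonneg hDd) hlog.le
  set n : ℕ := ⌊L⌋₊ with hn
  have hnL : (n : ℝ) ≤ L := Nat.floor_le hL0
  have hLn : L < n + 1 := Nat.lt_floor_add_one L
  have hpow : ∀ m : ℕ, μ ^ m = Real.exp (m * Real.log μ) := fun m => by
    rw [Real.exp_nat_mul, Real.exp_log hμ0]
  have hDexp : D / d₁ = Real.exp (L * Real.log μ) := by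
    rw [hL, div_mul_cancel₀ _ hlog.ne', Real.exp_log (by positivity)]
  refine ⟨n, ?_, ?_⟩
  · have h1 : μ ^ n ≤ D / d₁ := by
      rw [hpow, hDexp]; exact Real.exp_le_exp.2 (by nlinarith)
    rwa [le_div_iff₀ hd₁] at h1
  · have h1 : D / d₁ < μ ^ (n + 1) := by
      rw [hpow, hDexp]; push_cast; exact Real.exp_lt_exp.2 (by nlinarith)
    rwa [div_lt_iff₀ hd₁] at h1

/-- **Every far-past slice is an orbit image of a window slice**: for `μ > 1`, `T₁ ≤ T`, every `s < T₁ − 1` has `n ∈ ℕ` and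
`τ ∈ [T − μ(T − T₁ + 1), T₁ − 1]` with `T − s = μⁿ (T − τ)`. [folklore] -/
theorem exists_window (hμ : 1 < μ) (hT : T₁ ≤ T) {s : ℝ} (hs : s < T₁ - 1) :
    ∃ (n : ℕ) (τ : ℝ), T - μ * (T - T₁ + 1) ≤ τ ∧ τ ≤ T₁ - 1 ∧ T - s = μ ^ n * (T - τ) := by
  have hμ0 : 0 < μ := by linarith
  set d₁ : ℝ := T - T₁ + 1 with hd₁
  have hd₁0 : 0 < d₁ := by rw [hd₁]; linarith
  obtain ⟨n, hn1, hn2⟩ := exists_geometric_window hμ hd₁0 (show d₁ ≤ T - s by rw [hd₁]; linarith)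
  have hμn : 0 < μ ^ n := pow_pos hμ0 n
  refine ⟨n, T - (T - s) / μ ^ n, ?_, ?_, ?_⟩
  · -- `(T − s)/μⁿ < μ d₁`
    have : (T - s) / μ ^ n < μ * d₁ := by
      rw [div_lt_iff₀ hμn, pow_succ] at *; linarith
    rw [hd₁] at this; linarith
  · -- `d₁ ≤ (T − s)/μⁿ`
    have : d₁ ≤ (T - s) / μ ^ n := by rw [le_div_iff₀ hμn]; linarith
    rw [hd₁] at this; linarith
  · rw [sub_sub_cancel, mul_comm, div_mul_cancel₀ (T - s) hμn.ne']

/-! ### Bounds on one window propagate to the whole past -/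

/-- `(μ^{e})^{n} = (μⁿ)^{e}` for natural `n` (`μ ≥ 0`). [folklore] -/
theorem rpow_pow_comm (hμ : 0 ≤ μ) (e : ℝ) (n : ℕ) : (μ ^ e) ^ n = (μ ^ n) ^ e := by
  rw [← Real.rpow_natCast, ← Real.rpow_mul hμ, ← Real.rpow_natCast, ← Real.rpow_mul hμ, mul_comm]

/-- **Velocity envelope from one window**: the discrete clock symmetry for `τ < T₁` (`T₁ ≤ T`, `μ > 1`, `g ≤ 1`) and `‖u(τ, ·)‖ ≤ B` for
`τ ∈ [T − μ(T − T₁ + 1), T₁)` ⇒ for every `s < T₁ − 1`, `‖u(s, x)‖ ≤ B (μ(T − T₁ + 1))^{1−g} (T − s)^{−(1−g)}`. [folklore] -/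
theorem norm_le_rpow_of_window (hT : T₁ ≤ T) (hμ : 1 < μ) (hg : g ≤ 1)
    (h : ∀ τ : ℝ, τ < T₁ → ∀ x, u τ x = μ ^ (1 - g) • u (T - μ * (T - τ)) (μ ^ g • x))
    {B : ℝ} (hB : ∀ τ : ℝ, T - μ * (T - T₁ + 1) ≤ τ → τ < T₁ → ∀ y, ‖u τ y‖ ≤ B)
    {s : ℝ} (hs : s < T₁ - 1) (x : EuclideanSpace ℝ (Fin 3)) :
    ‖u s x‖ ≤ B * (μ * (T - T₁ + 1)) ^ (1 - g) * (T - s) ^ (-(1 - g)) := by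
  have hμ0 : 0 < μ := by linarith
  obtain ⟨n, τ, hτ1, hτ2, hsτ⟩ := exists_window hμ hT hs
  have hτ : τ < T₁ := by linarith
  have hd : 0 < T - τ := by linarith
  have hD : 0 < T - s := by linarith
  have hμn : 0 < μ ^ n := pow_pos hμ0 n
  -- the slice along the orbit
  have hit := iterate hT hμ.le h n τ hτ x
  rw [show T - μ ^ n * (T - τ) = s by linarith] at hit
  have ha : 0 < (μ ^ (1 - g)) ^ n := pow_pos (Real.rpow_pos_of_pos hμ0 _) n
  rw [hit, norm_smul, norm_inv, Real.norm_of_nonneg ha.le]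
  -- `((μ^{1−g})ⁿ)⁻¹ = ((T−τ)/(T−s))^{1−g} ≤ (μ d₁)^{1−g} (T−s)^{−(1−g)}`
  have hR : μ ^ n = (T - s) / (T - τ) := by
    rw [eq_div_iff hd.ne']; linarith
  have hratio : ((μ ^ (1 - g)) ^ n)⁻¹ = (T - τ) ^ (1 - g) * (T - s) ^ (-(1 - g)) := by
    rw [rpow_pow_comm hμ0.le, ← Real.inv_rpow hμn.le, hR, inv_div, Real.div_rpow hd.le hD.le, Real.rpow_neg hD.le,
      div_eq_mul_inv]
  have hmono : (T - τ) ^ (1 - g) ≤ (μ * (T - T₁ + 1)) ^ (1 - g) :=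
    Real.rpow_le_rpow hd.le (by linarith) (by linarith)
  rw [hratio]
  have hDp : 0 ≤ (T - s) ^ (-(1 - g)) := Real.rpow_nonneg hD.le _
  calc (T - τ) ^ (1 - g) * (T - s) ^ (-(1 - g)) * ‖u τ (((μ ^ g) ^ n)⁻¹ • x)‖
      ≤ (μ * (T - T₁ + 1)) ^ (1 - g) * (T - s) ^ (-(1 - g)) * B :=
        mul_le_mul (mul_le_mul_of_nonneg_right hmono hDp) (hB τ hτ1 hτ _) (norm_nonneg _)
          (mul_nonneg (Real.rpow_nonneg (by nlinarith) _) hDp)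
    _ = B * (μ * (T - T₁ + 1)) ^ (1 - g) * (T - s) ^ (-(1 - g)) := by ring

/-- **The slice gradient along the orbit**: with `T − s = μⁿ(T − τ)`, `∇u(s, ·)(x) = μ^{−n} • ∇u(τ, ·)((μ^{g})^{−n} x)` (`u(τ, ·)` differentiable):
the amplitude factor `(μ^{1−g})^{−n}` and the chain-rule factor `(μ^{g})^{−n}` multiply to `μ^{−n}`. [folklore] -/
theorem hasFDerivAt_slice (hT : T₁ ≤ T) (hμ : 1 ≤ μ)
    (h : ∀ τ : ℝ, τ < T₁ → ∀ x, u τ x = μ ^ (1 - g) • u (T - μ * (T - τ)) (μ ^ g • x))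
    (n : ℕ) {τ : ℝ} (hτ : τ < T₁) (hd : Differentiable ℝ (u τ)) (x : EuclideanSpace ℝ (Fin 3)) :
    HasFDerivAt (u (T - μ ^ n * (T - τ))) ((μ ^ n)⁻¹ • fderiv ℝ (u τ) (((μ ^ g) ^ n)⁻¹ • x)) x := by
  have hμ0 : 0 < μ := by linarith
  have hμn : 0 < μ ^ n := pow_pos hμ0 n
  have ha : 0 < (μ ^ (1 - g)) ^ n := pow_pos (Real.rpow_pos_of_pos hμ0 _) n
  have hb : 0 < (μ ^ g) ^ n := pow_pos (Real.rpow_pos_of_pos hμ0 _) n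
  have hus : u (T - μ ^ n * (T - τ)) = fun x => ((μ ^ (1 - g)) ^ n)⁻¹ • u τ (((μ ^ g) ^ n)⁻¹ • x) :=
    funext fun x => iterate hT hμ h n τ hτ x
  rw [hus]
  have h1 : HasFDerivAt (fun y : EuclideanSpace ℝ (Fin 3) => ((μ ^ g) ^ n)⁻¹ • y)
      (((μ ^ g) ^ n)⁻¹ • ContinuousLinearMap.id ℝ (EuclideanSpace ℝ (Fin 3))) x :=
    (ContinuousLinearMap.id ℝ (EuclideanSpace ℝ (Fin 3))).hasFDerivAt.const_smul (((μ ^ g) ^ n)⁻¹)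
  have h2 := ((hd (((μ ^ g) ^ n)⁻¹ • x)).hasFDerivAt.comp x h1).const_smul (((μ ^ (1 - g)) ^ n)⁻¹)
  refine h2.congr_fderiv (ContinuousLinearMap.ext fun v => ?_)
  simp only [FunLike.coe_smul, Pi.smul_apply, ContinuousLinearMap.comp_apply, ContinuousLinearMap.id_apply, map_smul,
    smul_smul]
  congr 1
  -- `(μ^{1−g})^{−n} (μ^{g})^{−n} = μ^{−n}`
  rw [rpow_pow_comm hμ0.le, rpow_pow_comm hμ0.le, ← mul_inv, ← Real.rpow_add hμn,
    show (1 - g) + g = 1 by ring, Real.rpow_one]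

/-- The norm of the slice gradient along the orbit: `‖∇u(s, x)‖ = μ^{−n} ‖∇u(τ, ·)((μ^{g})^{−n} x)‖`. [folklore] -/
theorem norm_fderiv_slice (hT : T₁ ≤ T) (hμ : 1 ≤ μ)
    (h : ∀ τ : ℝ, τ < T₁ → ∀ x, u τ x = μ ^ (1 - g) • u (T - μ * (T - τ)) (μ ^ g • x))
    (n : ℕ) {τ : ℝ} (hτ : τ < T₁) (hd : Differentiable ℝ (u τ)) (x : EuclideanSpace ℝ (Fin 3)) :
    ‖fderiv ℝ (u (T - μ ^ n * (T - τ))) x‖ = (μ ^ n)⁻¹ * ‖fderiv ℝ (u τ) (((μ ^ g) ^ n)⁻¹ • x)‖ := by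
  have hμn : 0 < μ ^ n := pow_pos (by linarith) n
  rw [(hasFDerivAt_slice hT hμ h n hτ hd x).fderiv, norm_smul, norm_inv, Real.norm_of_nonneg hμn.le]

variable {C q : ℝ}

/-- **Uniform Lipschitz bound from one window**: `‖∇u(τ, ·)‖ ≤ C` for `τ ∈ [T − μ(T − T₁ + 1), T₁)` ⇒ `‖∇u(s, ·)‖ ≤ C` for every
`s < T₁ − 1` (`μ^{−n} ≤ 1`). [folklore] -/
theorem norm_fderiv_le_of_window (hT : T₁ ≤ T) (hμ : 1 < μ)
    (h : ∀ τ : ℝ, τ < T₁ → ∀ x, u τ x = μ ^ (1 - g) • u (T - μ * (T - τ)) (μ ^ g • x))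
    (hd : ∀ τ : ℝ, τ < T₁ → Differentiable ℝ (u τ))
    (hC : ∀ τ : ℝ, T - μ * (T - T₁ + 1) ≤ τ → τ < T₁ → ∀ y, ‖fderiv ℝ (u τ) y‖ ≤ C)
    {s : ℝ} (hs : s < T₁ - 1) (x : EuclideanSpace ℝ (Fin 3)) : ‖fderiv ℝ (u s) x‖ ≤ C := by
  have hμ0 : 0 < μ := by linarith
  obtain ⟨n, τ, hτ1, hτ2, hsτ⟩ := exists_window hμ hT hs
  have hτ : τ < T₁ := by linarith
  have hC0 : 0 ≤ C := (norm_nonneg _).trans (hC τ hτ1 hτ 0)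
  have hslice := norm_fderiv_slice hT hμ.le h n hτ (hd τ hτ) x
  rw [show T - μ ^ n * (T - τ) = s by linarith] at hslice
  rw [hslice]
  have hμn1 : 1 ≤ μ ^ n := one_le_pow₀ hμ.le
  have hinv : (μ ^ n)⁻¹ ≤ 1 := inv_le_one_of_one_le₀ hμn1
  have hinv0 : 0 ≤ (μ ^ n)⁻¹ := inv_nonneg.2 (by positivity)
  calc (μ ^ n)⁻¹ * ‖fderiv ℝ (u τ) (((μ ^ g) ^ n)⁻¹ • x)‖ ≤ 1 * C :=
        mul_le_mul hinv (hC τ hτ1 hτ _) (norm_nonneg _) zero_le_one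
    _ = C := one_mul C

/-- **Algebraic decay of the gradient off a ball, from one window** (`g < 0`, `q > 0`): `‖∇u(τ, y)‖ ≤ C(1 + ‖y‖)^{−q}` for
`τ ∈ [T − μ(T − T₁ + 1), T₁)` ⇒ for `s < T₁ − 1` and `‖x‖ ≥ δ > 0`,
`‖∇u(s, x)‖ ≤ C δ^{−q} (μ(T − T₁ + 1))^{1−gq} (T − s)^{−(1−gq)}`. [folklore] -/
theorem norm_fderiv_le_of_window_of_le_norm (hT : T₁ ≤ T) (hμ : 1 < μ) (hg : g < 0)
    (h : ∀ τ : ℝ, τ < T₁ → ∀ x, u τ x = μ ^ (1 - g) • u (T - μ * (T - τ)) (μ ^ g • x))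
    (hd : ∀ τ : ℝ, τ < T₁ → Differentiable ℝ (u τ)) (hq : 0 < q)
    (htame : ∀ τ : ℝ, T - μ * (T - T₁ + 1) ≤ τ → τ < T₁ → ∀ y, ‖fderiv ℝ (u τ) y‖ ≤ C * (1 + ‖y‖) ^ (-q))
    {δ : ℝ} (hδ : 0 < δ) {s : ℝ} (hs : s < T₁ - 1) {x : EuclideanSpace ℝ (Fin 3)} (hx : δ ≤ ‖x‖) :
    ‖fderiv ℝ (u s) x‖ ≤ C * δ ^ (-q) * (μ * (T - T₁ + 1)) ^ (1 - g * q) * (T - s) ^ (-(1 - g * q)) := by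
  have hμ0 : 0 < μ := by linarith
  obtain ⟨n, τ, hτ1, hτ2, hsτ⟩ := exists_window hμ hT hs
  have hτ : τ < T₁ := by linarith
  have hd' : 0 < T - τ := by linarith
  have hD : 0 < T - s := by linarith
  have hC0 : 0 ≤ C := by
    have h0 := htame τ hτ1 hτ 0
    rw [norm_zero, add_zero, Real.one_rpow, mul_one] at h0
    exact (norm_nonneg _).trans h0
  have hslice := norm_fderiv_slice hT hμ.le h n hτ (hd τ hτ) x
  rw [show T - μ ^ n * (T - τ) = s by linarith] at hslice
  rw [hslice]
  have hμn : 0 < μ ^ n := pow_pos hμ0 n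
  -- the chain-rule factor `r := (μ^g)^{−n} = (μⁿ)^{−g}`: only its positivity and the product with `δ` are used
  set r : ℝ := ((μ ^ g) ^ n)⁻¹ with hr
  have hr' : r = (μ ^ n) ^ (-g) := by rw [hr, rpow_pow_comm hμ0.le, Real.rpow_neg hμn.le]
  have hr0 : 0 < r := by rw [hr']; exact Real.rpow_pos_of_pos hμn _
  -- the tame bound at the rescaled point
  have hz : r * δ ≤ 1 + ‖r • x‖ := by
    rw [norm_smul, Real.norm_of_nonneg hr0.le]; nlinarith
  have h1 : (1 + ‖r • x‖) ^ (-q) ≤ (r * δ) ^ (-q) := Real.rpow_le_rpow_of_nonpos (by positivity) hz (by linarith)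
  have h2 : (r * δ) ^ (-q) = δ ^ (-q) * (μ ^ n) ^ (g * q) := by
    rw [Real.mul_rpow hr0.le hδ.le, hr', ← Real.rpow_mul hμn.le, mul_comm]
    congr 1; ring_nf
  have h3 : ‖fderiv ℝ (u τ) (r • x)‖ ≤ C * (δ ^ (-q) * (μ ^ n) ^ (g * q)) :=
    (htame τ hτ1 hτ _).trans (mul_le_mul_of_nonneg_left (h1.trans h2.le) hC0)
  -- `μ^{−n} (μⁿ)^{gq} = (μⁿ)^{−(1−gq)} = ((T−τ)/(T−s))^{1−gq} ≤ (μ d₁)^{1−gq} (T−s)^{−(1−gq)}`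
  have hR : μ ^ n = (T - s) / (T - τ) := by
    rw [eq_div_iff hd'.ne']; linarith
  have hpow : (μ ^ n)⁻¹ * (μ ^ n) ^ (g * q) = (T - τ) ^ (1 - g * q) * (T - s) ^ (-(1 - g * q)) := by
    calc (μ ^ n)⁻¹ * (μ ^ n) ^ (g * q) = (μ ^ n) ^ (-1 : ℝ) * (μ ^ n) ^ (g * q) := by rw [Real.rpow_neg_one]
      _ = (μ ^ n) ^ (-(1 - g * q)) := by rw [← Real.rpow_add hμn]; congr 1; ring
      _ = ((T - τ) / (T - s)) ^ (1 - g * q) := by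
          rw [hR, Real.rpow_neg (div_nonneg hD.le hd'.le), ← Real.inv_rpow (div_nonneg hD.le hd'.le), inv_div]
      _ = (T - τ) ^ (1 - g * q) * (T - s) ^ (-(1 - g * q)) := by
          rw [Real.div_rpow hd'.le hD.le, Real.rpow_neg hD.le, div_eq_mul_inv]
  have hmono : (T - τ) ^ (1 - g * q) ≤ (μ * (T - T₁ + 1)) ^ (1 - g * q) :=
    Real.rpow_le_rpow hd'.le (by linarith) (by nlinarith [mul_pos_of_neg_of_neg hg (neg_lt_zero.2 hq)])
  have hDp : 0 ≤ (T - s) ^ (-(1 - g * q)) := Real.rpow_nonneg hD.le _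
  calc (μ ^ n)⁻¹ * ‖fderiv ℝ (u τ) (r • x)‖
      ≤ (μ ^ n)⁻¹ * (C * (δ ^ (-q) * (μ ^ n) ^ (g * q))) := mul_le_mul_of_nonneg_left h3 (inv_nonneg.2 hμn.le)
    _ = C * δ ^ (-q) * ((μ ^ n)⁻¹ * (μ ^ n) ^ (g * q)) := by ring
    _ = C * δ ^ (-q) * ((T - τ) ^ (1 - g * q) * (T - s) ^ (-(1 - g * q))) := by rw [hpow]
    _ ≤ C * δ ^ (-q) * ((μ * (T - T₁ + 1)) ^ (1 - g * q) * (T - s) ^ (-(1 - g * q))) :=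
        mul_le_mul_of_nonneg_left (mul_le_mul_of_nonneg_right hmono hDp) (by positivity)
    _ = C * δ ^ (-q) * (μ * (T - T₁ + 1)) ^ (1 - g * q) * (T - s) ^ (-(1 - g * q)) := by ring

/-! ### Member level -/

/-- **TAME NEGATIVE-RATE DISCRETE CLOCKS ARE TRIVIAL.**  Crux hypotheses verbatim (`0 < ρ ≤ ½`) + `(u, p)` classical on a past sub-slab `(−∞, T₁)`,
`T₁ ≤ 0`, `T₁ ≤ T` + the discrete clock symmetry about the time `T`, `u(τ, x) = μ^{1−g} · u(T − μ(T−τ), μ^{g} x)` for `τ < T₁`, with ONE factor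
`μ > 1` and a NEGATIVE rate `g < 0` + TAMENESS ON ONE PERIOD WINDOW `τ ∈ [T − μ(T − T₁ + 1), T₁)`: `‖u(τ, y)‖ ≤ B`, `‖∇u(τ, y)‖ ≤ C(1 + ‖y‖)^{−q}`
(`q > 0`) ⇒ `u = 0` a.e. on `(−∞, 0) × ℝ³`.  On `(−∞, T₁ − 1)` the member has an algebraically fading tame past — envelope `B(μd₁)^{1−g}(T−s)^{−(1−g)}`
(`1 − g > 1`), `C`-Lipschitz slices, `‖∇u(s, x)‖ ≤ Cδ^{−q}(μd₁)^{1−gq}(T−s)^{−(1−gq)}` off the `δ`-ball (`1 − gq > 1`), `d₁ = T − T₁ + 1` — so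
`FadingPowerPast.ae_eq_zero_of_gauge_of_fadingPowerPast_of_norm_fderiv_le` applies.  The exact clocks `(T−τ)^{g−1}W((T−τ)^{−g}x)` with a tame
profile are the case `μ` arbitrary (`NegRateClock.ae_eq_zero_of_gauge_of_tameNegRateClock`); for them the weak class is settled by
`NegClock.selfSimilar_ae_eq_zero_of_neg_rate_past`, but a DISCRETE clock has no profile. [folklore; line card `Lines/logtime-breathers.md` T4/T5] -/
theorem ae_eq_zero_of_gauge_of_tame {ρ : ℝ} (hρ : 0 < ρ) (hρh : ρ ≤ 1 / 2)
    {H : ℝ → EuclideanSpace ℝ (Fin 3) → EuclideanSpace ℝ (Fin 3) →L[ℝ] EuclideanSpace ℝ (Fin 3)} {c₀ : ℝ≥0}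
    (hsw : IsSuitableWeakSolutionOn (slab (EuclideanSpace ℝ (Fin 3)) (Iio 0) isOpen_Iio) 0 0 u p)
    (hH : HasWeakSpatialGradientOn (slab (EuclideanSpace ℝ (Fin 3)) (Iio 0) isOpen_Iio) u H)
    (hgauge : ∀ a : ℝ, 0 < a →
      ENNReal.ofReal (a ^ (2 * ρ)) * cknA a (0 : ℝ × EuclideanSpace ℝ (Fin 3)) u +
          ENNReal.ofReal (a ^ ρ) * cknE a (0 : ℝ × EuclideanSpace ℝ (Fin 3)) H +
        ENNReal.ofReal (a ^ (2 * ρ)) * cknD a (0 : ℝ × EuclideanSpace ℝ (Fin 3)) p ≤ (c₀ : ℝ≥0∞))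
    (hT₁ : T₁ ≤ 0) (hT : T₁ ≤ T) (hcl : IsClassicalEulerSolutionOn (Iio T₁) 0 u p) (hμ : 1 < μ) (hg : g < 0)
    (h : ∀ τ : ℝ, τ < T₁ → ∀ x, u τ x = μ ^ (1 - g) • u (T - μ * (T - τ)) (μ ^ g • x))
    {B : ℝ} (hB : ∀ τ : ℝ, T - μ * (T - T₁ + 1) ≤ τ → τ < T₁ → ∀ y, ‖u τ y‖ ≤ B)
    (htame : ∃ C q : ℝ, 0 < q ∧ ∀ τ : ℝ, T - μ * (T - T₁ + 1) ≤ τ → τ < T₁ → ∀ y, ‖fderiv ℝ (u τ) y‖ ≤ C * (1 + ‖y‖) ^ (-q)) :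
    uncurry u =ᵐ[volume.restrict (Iio (0 : ℝ) ×ˢ (univ : Set (EuclideanSpace ℝ (Fin 3))))] 0 := by
  obtain ⟨C, q, hq, htame⟩ := htame
  have hd : ∀ τ : ℝ, τ < T₁ → Differentiable ℝ (u τ) := fun τ hτ =>
    (hcl.contDiff_velocity hτ).differentiable (by simp)
  -- the window gradient bound `‖∇u τ y‖ ≤ C`
  have hC : ∀ τ : ℝ, T - μ * (T - T₁ + 1) ≤ τ → τ < T₁ → ∀ y, ‖fderiv ℝ (u τ) y‖ ≤ C := by
    intro τ h1 h2 y
    have hC0 : 0 ≤ C := by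
      have h0 := htame τ h1 h2 0
      rw [norm_zero, add_zero, Real.one_rpow, mul_one] at h0
      exact (norm_nonneg _).trans h0
    refine (htame τ h1 h2 y).trans ?_
    have : (1 + ‖y‖) ^ (-q) ≤ 1 := Real.rpow_le_one_of_one_le_of_nonpos (by nlinarith [norm_nonneg y]) (by linarith)
    nlinarith
  -- shrink the sub-slab
  have hT₁' : T₁ - 1 ≤ 0 := by linarith
  have hT' : T₁ - 1 ≤ T := by linarith
  have hcl' : IsClassicalEulerSolutionOn (Iio (T₁ - 1)) 0 u p :=
    hcl.mono (Iio_subset_Iio (by linarith)) (uniqueDiffOn_Iio _)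
  have hm : (1 : ℝ) < 1 - g := by linarith
  have hvel : ∀ s : ℝ, s < T₁ - 1 → ∀ y, ‖u s y‖ ≤ B * (μ * (T - T₁ + 1)) ^ (1 - g) * (T - s) ^ (-(1 - g)) :=
    fun s hs y => norm_le_rpow_of_window hT hμ (hg.le.trans zero_le_one) h hB hs y
  have hK : ∀ s : ℝ, s < T₁ - 1 → ∀ y, ‖fderiv ℝ (u s) y‖ ≤ C :=
    fun s hs y => norm_fderiv_le_of_window hT hμ h hd hC hs y
  have hgrad : ∀ δ : ℝ, 0 < δ → ∃ D k : ℝ, 1 < k ∧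
      ∀ s : ℝ, s < T₁ - 1 → ∀ y : EuclideanSpace ℝ (Fin 3), δ ≤ ‖y‖ → ‖fderiv ℝ (u s) y‖ ≤ D * (T - s) ^ (-k) := by
    intro δ hδ
    refine ⟨C * δ ^ (-q) * (μ * (T - T₁ + 1)) ^ (1 - g * q), 1 - g * q, ?_,
      fun s hs y hy => norm_fderiv_le_of_window_of_le_norm hT hμ hg h hd hq htame hδ hs hy⟩
    nlinarith [mul_pos_of_neg_of_neg hg (neg_lt_zero.2 hq)]
  exact FadingPowerPast.ae_eq_zero_of_gauge_of_fadingPowerPast_of_norm_fderiv_le hρ hρh hsw hH hgauge hT₁' hT' hcl' hm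
    hvel hK hgrad

end NegRateDiscreteClock

end Summit.NavierStokesRegularity.NavierStokesRegularity.Theorems.PowerGaugeEulerLiouville

end
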